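import Mathlib
import HarnessLib
import Summits.HubbardSuperconductivity.HubbardSuperconductivity.Theorems.KLProgrammeKLRegimeCountertermJacksonSplitDefs
import Summits.HubbardSuperconductivity.HubbardSuperconductivity.Theorems.KLProgrammeKLRegimeCountertermJacksonFrameBounds

/-!
# Route `KLProgramme`, crux K3 — gen-5 ENGINE child (`stub_twoLeg_step`, (E3a-MS) supplier, recipe (L)+(F), plan g12 STATUS l.1769):
# the LOW PART of the Jackson frequency split, I — `𝒥_d` preserves the frame symmetries, and `jlow d F = 2𝒥_dF − 𝒥_d²F` IS a
# `TrigPolyC4v` of degree `2d` (so the low parts of deep frame pieces are again frame pieces)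

Seat hubbard-kl-k3c3-p1 (g3), package (P1) of MS-DESIGN-NOTE §3–§4 (evidence #29 on stmt-…-19855).

* §1 `continuous_jsmooth` (for continuous `F`), `jsmooth_periodic` / `jsmooth_refl` / `jsmooth_swap`: the Jackson mean of a symmetric frame is a
  symmetric frame (periodicity pointwise, reflection by `t ↦ −t` and evenness of `J̃_d`, swap by Fubini);
* §2 `jlowFrame d F : TrigPolyC4v` (degree `2d`, coefficients `ĵ_k ĵ_l (2A_F(k,l) − A_{𝒥F}(k,l))`) and **`eval_jlowFrame`**:
  `(jlowFrame d F).eval p = jlow d F p` for a symmetric frame `F` ((J1) twice).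

Pure real analysis; nothing about the model.  The Bernstein-type derivative bound of the low part is part II.
-/

noncomputable section

namespace Summit.HubbardSuperconductivity.HubbardSuperconductivity.Theorems.KLRegimeSplit

set_option linter.dupNamespace false -- summit = problem name (single-conjunct summit), D-0017

open Real Finset MeasureTheory intervalIntegral
open Literature.MathematicalPhysics.QuantumLattice

/-! ## §1 Continuity and symmetries of the Jackson mean -/

section Symm

variable (d : ℕ) {F : (Fin 2 → ℝ) → ℝ}

/-- Joint continuity of `(p, s, t) ↦ J̃(s)J̃(t)F(p₀ − s, p₁ − t)`. -/
theorem continuous_jsmoothIntegrand₃ (hF : Continuous F) :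
    Continuous fun x : ((Fin 2 → ℝ) × ℝ) × ℝ => jker d x.1.2 * jker d x.2 * F ![x.1.1 0 - x.1.2, x.1.1 1 - x.2] := by
  have h1 : Continuous fun x : ((Fin 2 → ℝ) × ℝ) × ℝ => F ![x.1.1 0 - x.1.2, x.1.1 1 - x.2] := by
    refine hF.comp (continuous_pi fun i => ?_)
    fin_cases i <;> simp <;> fun_prop
  exact (((continuous_jker d).comp (continuous_snd.comp continuous_fst)).mul ((continuous_jker d).comp continuous_snd)).mul h1

/-- **The Jackson mean of a continuous function is continuous.** -/
theorem continuous_jsmooth (hF : Continuous F) : Continuous (jsmooth d F) := by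
  have hinner : Continuous fun x : (Fin 2 → ℝ) × ℝ => ∫ t in (-π)..π, jker d x.2 * jker d t * F ![x.1 0 - x.2, x.1 1 - t] :=
    intervalIntegral.continuous_parametric_intervalIntegral_of_continuous' (continuous_jsmoothIntegrand₃ d hF) _ _
  exact intervalIntegral.continuous_parametric_intervalIntegral_of_continuous' hinner _ _

/-- **Periodicity is preserved.** -/
theorem jsmooth_periodic (hper : ∀ (p : Fin 2 → ℝ) (z : Fin 2 → ℤ), F (fun i => p i + z i * (2 * π)) = F p)
    (p : Fin 2 → ℝ) (z : Fin 2 → ℤ) : jsmooth d F (fun i => p i + z i * (2 * π)) = jsmooth d F p := by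
  unfold jsmooth
  refine intervalIntegral.integral_congr fun s _ => intervalIntegral.integral_congr fun t _ => ?_
  have h := hper ![p 0 - s, p 1 - t] z
  have e : (fun i => (![p 0 - s, p 1 - t] : Fin 2 → ℝ) i + z i * (2 * π)) =
      ![p 0 + z 0 * (2 * π) - s, p 1 + z 1 * (2 * π) - t] := by
    funext i; fin_cases i <;> simp <;> ring
  rw [e] at h
  simp only [h]

/-- **Reflection symmetry is preserved** (`t ↦ −t` and evenness of the kernel). -/
theorem jsmooth_refl (hrefl : ∀ p : Fin 2 → ℝ, F ![p 0, -p 1] = F p) (p : Fin 2 → ℝ) :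
    jsmooth d F ![p 0, -p 1] = jsmooth d F p := by
  unfold jsmooth
  refine intervalIntegral.integral_congr fun s _ => ?_
  simp only [Matrix.cons_val_zero, Matrix.cons_val_one]
  have h := intervalIntegral.integral_comp_neg (a := -π) (b := π) (fun t => jker d s * jker d t * F ![p 0 - s, -p 1 - t])
  rw [neg_neg] at h
  rw [← h]
  refine intervalIntegral.integral_congr fun t _ => ?_
  have hr := hrefl ![p 0 - s, p 1 - t]
  simp only [Matrix.cons_val_zero, Matrix.cons_val_one] at hr
  simp only [jker_neg]
  rw [show -p 1 - -t = -(p 1 - t) by ring, hr]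

/-- **Swap symmetry is preserved** (Fubini). -/
theorem jsmooth_swap (hF : Continuous F) (hswap : ∀ p : Fin 2 → ℝ, F ![p 1, p 0] = F p) (p : Fin 2 → ℝ) :
    jsmooth d F ![p 1, p 0] = jsmooth d F p := by
  unfold jsmooth
  simp only [Matrix.cons_val_zero, Matrix.cons_val_one]
  rw [MeasureTheory.intervalIntegral_intervalIntegral_swap]
  · refine intervalIntegral.integral_congr fun s _ => intervalIntegral.integral_congr fun t _ => ?_
    have hs := hswap ![p 0 - s, p 1 - t]
    simp only [Matrix.cons_val_one, Matrix.cons_val_zero] at hs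
    rw [hs]; ring
  · have hcont : Continuous (Function.uncurry fun s t : ℝ => jker d s * jker d t * F ![p 1 - s, p 0 - t]) :=
      continuous_jsmoothIntegrand d hF ![p 1, p 0]
    exact (hcont.continuousOn.integrableOn_compact
      ((isCompact_uIcc (a := -π) (b := π)).prod (isCompact_uIcc (a := -π) (b := π)))).mono_set
      (Set.prod_mono Set.uIoc_subset_uIcc Set.uIoc_subset_uIcc)

end Symm

/-! ## §2 The low part as a frame -/

section LowFrame

variable (d : ℕ)

/-- **The low part as a `TrigPolyC4v`** of degree `2d`: coefficients `ĵ_k ĵ_l · (2A_F(k,l) − A_{𝒥_dF}(k,l))`. -/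
def jlowFrame (F : (Fin 2 → ℝ) → ℝ) : TrigPolyC4v :=
  ⟨d + d, fun k l => jkerCoeff d k * jkerCoeff d l * (2 * cosMoment F k l - cosMoment (jsmooth d F) k l)⟩

variable {F : (Fin 2 → ℝ) → ℝ}

/-- The low frame evaluates to `2·(jacksonFrame d F) − jacksonFrame d (𝒥_dF)` (linearity in the coefficients). -/
theorem eval_jlowFrame_eq (F : (Fin 2 → ℝ) → ℝ) (p : Fin 2 → ℝ) :
    (jlowFrame d F).eval p = 2 * (jacksonFrame d F).eval p - (jacksonFrame d (jsmooth d F)).eval p := by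
  simp only [jlowFrame, jacksonFrame, TrigPolyC4v.eval_def, Finset.mul_sum, ← Finset.sum_sub_distrib]
  refine Finset.sum_congr rfl fun k _ => Finset.sum_congr rfl fun l _ => ?_
  ring

/-- **The low part IS a frame**: `(jlowFrame d F).eval p = jlow d F p` for a symmetric frame `F` (continuous, `2π`-periodic, reflection-
and swap-symmetric) — (J1) for `F` and for `𝒥_dF`, which is again a symmetric frame (§1). -/
theorem eval_jlowFrame (hF : Continuous F)
    (hper : ∀ (p : Fin 2 → ℝ) (z : Fin 2 → ℤ), F (fun i => p i + z i * (2 * π)) = F p)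
    (hrefl : ∀ p : Fin 2 → ℝ, F ![p 0, -p 1] = F p) (hswap : ∀ p : Fin 2 → ℝ, F ![p 1, p 0] = F p) (p : Fin 2 → ℝ) :
    (jlowFrame d F).eval p = jlow d F p := by
  rw [eval_jlowFrame_eq, eval_jacksonFrame hF hper hrefl hswap,
    eval_jacksonFrame (continuous_jsmooth d hF) (jsmooth_periodic d hper) (jsmooth_refl d hrefl) (jsmooth_swap d hF hswap),
    jlow_apply]

/-- The low frame's degree is `2d`. -/
theorem jlowFrame_degree (F : (Fin 2 → ℝ) → ℝ) : (jlowFrame d F).degree = d + d := rfl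

end LowFrame

end Summit.HubbardSuperconductivity.HubbardSuperconductivity.Theorems.KLRegimeSplit

end
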